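import Mathlib.Analysis.SpecialFunctions.ImproperIntegrals
import Mathlib.Analysis.Calculus.ParametricIntegral
import Mathlib.Analysis.InnerProductSpace.Calculus
import Mathlib.Analysis.Complex.RealDeriv
import Mathlib.Analysis.Complex.Convex
import Literature.Analysis.UnboundedOperators.UnitaryGroupSmearing
import HarnessLib

/-!
# Analytic continuation of a positive-energy unitary group to the upper half-plane

Topic `Literature/Analysis/UnboundedOperators`, proofs layer over `UnitaryRep.lean` (item C4) and
`UnitaryGroupSmearing.lean`. Let `T(s) = e^{isP}` be a strongly continuous one-parameter unitary group
on a complex Hilbert space with **positive energy** (`T.HasPositiveEnergy`: the Stone generator `P` is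
symmetric with `0 ≤ ⟪x, P x⟫` on `D(P)`). Classically (spectral theorem) `w ↦ e^{iwP}`, `Im w ≥ 0`, is
a strongly continuous family of contractions, holomorphic on the open upper half-plane, extending
`s ↦ T(s)`; this is the ingredient "as `P ≥ 0` and `Im e^{2πz}s ≥ 0` for `z ∈ 𝕊_{1/2}`, the function is
bounded analytic" of the one-particle Borchers theorem (R. Longo, *Lectures on Conformal Nets I*,
Thm. 2.2.1; Longo–Witten, CMP 303 (2011), Thm. 2.2). Mathlib has no spectral theorem for unbounded
self-adjoint operators, so this file gives an elementary construction
(`exists_upperHalfPlane_extension`):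

* the extension is the **Poisson smearing** `W(w) x = ∫ (π(1+u²))⁻¹ T(Re w + u Im w) x du`
  (manifestly `‖W(w)‖ ≤ 1`, jointly strongly continuous on `ℂ × H`, and `W(s) = T(s)` for real `s`);
* the key lemma `integral_inv_sq_smul_appReal_eq_zero`: **`∫ (s - μ)⁻² T(s) x ds = 0` for `Im μ < 0`**.
  Proof from form-positivity alone: `y(b) = ∫ (s - a + ib)⁻² T(s)x ds` lies in `D(P)` with
  `d/db y(b) = P y(b)`, so `d/db ‖y(b)‖² = 2⟪y, P y⟫ ≥ 0`, while `‖y(b)‖ ≤ π‖x‖/b → 0` as `b → ∞`;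
  a non-decreasing non-negative function tending to `0` vanishes;
* consequently the smearing against `(s - ν)⁻¹ - (s + i)⁻¹` vanishes for `Im ν < 0` (its
  `ν`-derivative is the previous integral, and it vanishes at `ν = -i`), so for `Im w > 0` the Poisson
  kernel `(2πi)⁻¹((s-w)⁻¹ - (s-w̄)⁻¹)` may be replaced by the Cauchy-type kernel
  `(2πi)⁻¹((s-w)⁻¹ - (s+i)⁻¹)`, which is holomorphic in `w`; the explicit second-order remainder
  `(w-w₀)²/((s-w)(s-w₀)²)` then gives differentiability of `w ↦ W(w)` in OPERATOR norm on `Im w > 0`.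

## References

* R. Longo, *Lectures on Conformal Nets. Part I: One Particle Structure* (2008), proof of Thm. 2.2.1
  (use of the bounded analytic continuation of `s ↦ e^{isP}`, `P ≥ 0`). [Longo2008LecturesConformalNets]
* M. Reed, B. Simon, *Methods of Modern Mathematical Physics II* (1975), §X.8 (holomorphic
  contraction semigroups; the spectral-theorem route). [ReedSimonII1975]

## Design notes

No definitions: the extension is provided existentially (`exists_upperHalfPlane_extension`), the
Poisson-smeared operator being characterised by
`∀ w x, W w x = ∫ u, ((π (1 + u²))⁻¹ : ℂ) • T(Re w + Im w u) x`.
-/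

noncomputable section

open Filter MeasureTheory Complex Set Metric Asymptotics
open scoped InnerProductSpace Topology ComplexConjugate

namespace Literature.Analysis.UnboundedOperators

namespace UnitaryRep

variable {H : Type*} [NormedAddCommGroup H] [InnerProductSpace ℂ H] [CompleteSpace H]

/-! ### Kernel estimates -/

/-- `‖s - μ‖² = (s - Re μ)² + (Im μ)²` for real `s`. [folklore] -/
theorem norm_sq_ofReal_sub (s : ℝ) (μ : ℂ) : ‖(s : ℂ) - μ‖ ^ 2 = (s - μ.re) ^ 2 + μ.im ^ 2 := by
  rw [Complex.sq_norm, Complex.normSq_apply]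
  simp only [sub_re, ofReal_re, sub_im, ofReal_im, zero_sub]
  ring

/-- `|Im μ| ≤ ‖s - μ‖` for real `s`. [folklore] -/
theorem abs_im_le_norm_ofReal_sub (s : ℝ) (μ : ℂ) : |μ.im| ≤ ‖(s : ℂ) - μ‖ := by
  have h := Complex.abs_im_le_norm ((s : ℂ) - μ)
  simpa [sub_im] using h

/-- `s - μ ≠ 0` for real `s` and `Im μ ≠ 0`. [folklore] -/
theorem ofReal_sub_ne_zero {μ : ℂ} (hμ : μ.im ≠ 0) (s : ℝ) : (s : ℂ) - μ ≠ 0 := by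
  intro h
  have := abs_im_le_norm_ofReal_sub s μ
  rw [h, norm_zero] at this
  exact hμ (abs_eq_zero.1 (le_antisymm this (abs_nonneg _)))

/-- The Poisson-type weight `((s - a)² + b²)⁻¹` is integrable for `b ≠ 0`. [folklore] -/
theorem integrable_inv_sub_sq_add_sq (a : ℝ) {b : ℝ} (hb : b ≠ 0) :
    Integrable fun s : ℝ => ((s - a) ^ 2 + b ^ 2)⁻¹ := by
  have h : Integrable fun s : ℝ => (1 + ((s - a) / b) ^ 2)⁻¹ :=
    (integrable_inv_one_add_sq.comp_div hb).comp_sub_right a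
  refine (h.const_mul (b ^ 2)⁻¹).congr (Eventually.of_forall fun s => ?_)
  simp only
  have hb2 : b ^ 2 ≠ 0 := pow_ne_zero 2 hb
  rw [← mul_inv]
  congr 1
  field_simp
  ring

/-- `∫ ((s - a)² + b²)⁻¹ ds = π / b` for `b > 0`. [folklore] -/
theorem integral_inv_sub_sq_add_sq (a : ℝ) {b : ℝ} (hb : 0 < b) :
    ∫ s : ℝ, ((s - a) ^ 2 + b ^ 2)⁻¹ = Real.pi / b := by
  have h1 : ∫ s : ℝ, ((s - a) ^ 2 + b ^ 2)⁻¹ = ∫ s : ℝ, (s ^ 2 + b ^ 2)⁻¹ :=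
    integral_sub_right_eq_self (fun s : ℝ => (s ^ 2 + b ^ 2)⁻¹) a
  have h2 : (fun s : ℝ => (s ^ 2 + b ^ 2)⁻¹) = fun s : ℝ => (b ^ 2)⁻¹ * (1 + (s / b) ^ 2)⁻¹ := by
    funext s
    have hb2 : b ^ 2 ≠ 0 := pow_ne_zero 2 hb.ne'
    rw [← mul_inv]
    congr 1
    field_simp
    ring
  rw [h1, h2, integral_const_mul, Measure.integral_comp_div (fun u : ℝ => (1 + u ^ 2)⁻¹) b,
    integral_univ_inv_one_add_sq, abs_of_pos hb, smul_eq_mul]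
  field_simp

/-- `‖((s - μ)²)⁻¹‖ = ((s - Re μ)² + (Im μ)²)⁻¹`. [folklore] -/
theorem norm_inv_ofReal_sub_sq (s : ℝ) (μ : ℂ) :
    ‖(((s : ℂ) - μ) ^ 2)⁻¹‖ = ((s - μ.re) ^ 2 + μ.im ^ 2)⁻¹ := by
  rw [norm_inv, norm_pow, norm_sq_ofReal_sub]

/-- `s ↦ (s - μ)⁻²` is integrable for `Im μ ≠ 0`. [folklore] -/
theorem integrable_inv_ofReal_sub_sq {μ : ℂ} (hμ : μ.im ≠ 0) :
    Integrable fun s : ℝ => (((s : ℂ) - μ) ^ 2)⁻¹ := by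
  refine (integrable_inv_sub_sq_add_sq μ.re hμ).mono' ?_ (Eventually.of_forall fun s => ?_)
  · exact (((continuous_ofReal.sub continuous_const).pow 2).inv₀
      (fun s => pow_ne_zero 2 (ofReal_sub_ne_zero hμ s))).aestronglyMeasurable
  · rw [norm_inv_ofReal_sub_sq]

/-- `∫ ‖(s - μ)⁻²‖ ds = π / |Im μ|`. [folklore] -/
theorem integral_norm_inv_ofReal_sub_sq {μ : ℂ} (hμ : μ.im ≠ 0) :
    ∫ s : ℝ, ‖(((s : ℂ) - μ) ^ 2)⁻¹‖ = Real.pi / |μ.im| := by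
  simp_rw [norm_inv_ofReal_sub_sq]
  rw [← sq_abs μ.im]
  exact integral_inv_sub_sq_add_sq μ.re (abs_pos.2 hμ)

/-- Geometry of a small ball around `μ₀` off the real axis: for `‖μ - μ₀‖ < |Im μ₀|/2` one has
`((s - Re μ₀)² + (Im μ₀)²)/8 ≤ ‖s - μ‖²` and `|Im μ₀|/2 ≤ |Im μ|`. [folklore] -/
theorem sq_add_sq_le_norm_sq_of_norm_sub_lt {μ₀ μ : ℂ} (h : ‖μ - μ₀‖ < |μ₀.im| / 2) (s : ℝ) :
    ((s - μ₀.re) ^ 2 + μ₀.im ^ 2) / 8 ≤ ‖(s : ℂ) - μ‖ ^ 2 ∧ |μ₀.im| / 2 ≤ |μ.im| := by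
  have hre : |μ.re - μ₀.re| < |μ₀.im| / 2 :=
    lt_of_le_of_lt (by simpa [sub_re] using Complex.abs_re_le_norm (μ - μ₀)) h
  have him : |μ.im - μ₀.im| < |μ₀.im| / 2 :=
    lt_of_le_of_lt (by simpa [sub_im] using Complex.abs_im_le_norm (μ - μ₀)) h
  have him' : |μ₀.im| / 2 ≤ |μ.im| := by
    have := abs_sub_abs_le_abs_sub μ₀.im μ.im
    rw [abs_sub_comm] at this
    linarith
  refine ⟨?_, him'⟩
  rw [norm_sq_ofReal_sub]
  have h1 : (μ.re - μ₀.re) ^ 2 ≤ (|μ₀.im| / 2) ^ 2 := by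
    rw [← sq_abs (μ.re - μ₀.re)]
    exact pow_le_pow_left₀ (abs_nonneg _) hre.le 2
  have h2 : (|μ₀.im| / 2) ^ 2 ≤ μ.im ^ 2 := by
    rw [← sq_abs μ.im]
    exact pow_le_pow_left₀ (by positivity) him' 2
  have h3 : (|μ₀.im|) ^ 2 = μ₀.im ^ 2 := sq_abs _
  nlinarith [sq_nonneg (s - μ.re - (μ.re - μ₀.re)), sq_nonneg (s - μ.re + (μ.re - μ₀.re))]

/-- Uniform bound `‖(s - μ)⁻²‖ ≤ 8 ((s - Re μ₀)² + (Im μ₀)²)⁻¹` on the ball `‖μ - μ₀‖ < |Im μ₀|/2`.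
[folklore] -/
theorem norm_inv_ofReal_sub_sq_le {μ₀ μ : ℂ} (h0 : μ₀.im ≠ 0) (h : ‖μ - μ₀‖ < |μ₀.im| / 2)
    (s : ℝ) : ‖(((s : ℂ) - μ) ^ 2)⁻¹‖ ≤ 8 * ((s - μ₀.re) ^ 2 + μ₀.im ^ 2)⁻¹ := by
  obtain ⟨h1, -⟩ := sq_add_sq_le_norm_sq_of_norm_sub_lt h s
  have hD : 0 < (s - μ₀.re) ^ 2 + μ₀.im ^ 2 := by positivity
  rw [norm_inv, norm_pow, show (8 : ℝ) * ((s - μ₀.re) ^ 2 + μ₀.im ^ 2)⁻¹ =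
    (((s - μ₀.re) ^ 2 + μ₀.im ^ 2) / 8)⁻¹ by rw [inv_div]; ring]
  exact inv_anti₀ (by positivity) h1

/-- Uniform bound `‖(s - μ)⁻¹‖ ≤ 2 / |Im μ₀|` on the ball `‖μ - μ₀‖ < |Im μ₀|/2`. [folklore] -/
theorem norm_inv_ofReal_sub_le {μ₀ μ : ℂ} (h0 : μ₀.im ≠ 0) (h : ‖μ - μ₀‖ < |μ₀.im| / 2)
    (s : ℝ) : ‖((s : ℂ) - μ)⁻¹‖ ≤ 2 / |μ₀.im| := by
  obtain ⟨-, h2⟩ := sq_add_sq_le_norm_sq_of_norm_sub_lt h s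
  have h3 : |μ₀.im| / 2 ≤ ‖(s : ℂ) - μ‖ := h2.trans (abs_im_le_norm_ofReal_sub s μ)
  have h4 : 0 < |μ₀.im| / 2 := by positivity
  rw [norm_inv, show (2 : ℝ) / |μ₀.im| = (|μ₀.im| / 2)⁻¹ by rw [inv_div]]
  exact inv_anti₀ h4 h3

/-- Uniform bound `‖(s - μ)⁻³‖ ≤ (16/|Im μ₀|) ((s - Re μ₀)² + (Im μ₀)²)⁻¹` on the ball
`‖μ - μ₀‖ < |Im μ₀|/2`. [folklore] -/
theorem norm_inv_ofReal_sub_pow_three_le {μ₀ μ : ℂ} (h0 : μ₀.im ≠ 0) (h : ‖μ - μ₀‖ < |μ₀.im| / 2)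
    (s : ℝ) : ‖(((s : ℂ) - μ) ^ 3)⁻¹‖ ≤ 16 / |μ₀.im| * ((s - μ₀.re) ^ 2 + μ₀.im ^ 2)⁻¹ := by
  have e : (((s : ℂ) - μ) ^ 3)⁻¹ = ((s : ℂ) - μ)⁻¹ * (((s : ℂ) - μ) ^ 2)⁻¹ := by
    rw [← mul_inv, ← pow_succ']
  rw [e, norm_mul, show 16 / |μ₀.im| * ((s - μ₀.re) ^ 2 + μ₀.im ^ 2)⁻¹ =
    (2 / |μ₀.im|) * (8 * ((s - μ₀.re) ^ 2 + μ₀.im ^ 2)⁻¹) by ring]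
  exact mul_le_mul (norm_inv_ofReal_sub_le h0 h s) (norm_inv_ofReal_sub_sq_le h0 h s)
    (norm_nonneg _) (by positivity)

/-- The difference of two Cauchy kernels, `(s - μ)⁻¹ - (s - ν)⁻¹ = (μ - ν)/((s - μ)(s - ν))`, is
integrable for `Im μ, Im ν ≠ 0`. [folklore] -/
theorem integrable_inv_ofReal_sub_sub_inv {μ ν : ℂ} (hμ : μ.im ≠ 0) (hν : ν.im ≠ 0) :
    Integrable fun s : ℝ => ((s : ℂ) - μ)⁻¹ - ((s : ℂ) - ν)⁻¹ := by
  have hint : Integrable fun s : ℝ =>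
      ‖μ - ν‖ / 2 * (((s - μ.re) ^ 2 + μ.im ^ 2)⁻¹ + ((s - ν.re) ^ 2 + ν.im ^ 2)⁻¹) :=
    ((integrable_inv_sub_sq_add_sq μ.re hμ).add (integrable_inv_sub_sq_add_sq ν.re hν)).const_mul _
  refine hint.mono' ?_ (Eventually.of_forall fun s => ?_)
  · exact (((continuous_ofReal.sub continuous_const).inv₀ (ofReal_sub_ne_zero hμ)).sub
      ((continuous_ofReal.sub continuous_const).inv₀ (ofReal_sub_ne_zero hν))).aestronglyMeasurable
  · have hp := ofReal_sub_ne_zero hμ s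
    have hq := ofReal_sub_ne_zero hν s
    rw [inv_sub_inv hp hq, norm_div, norm_mul, ← norm_sq_ofReal_sub, ← norm_sq_ofReal_sub]
    have e1 : (s : ℂ) - ν - ((s : ℂ) - μ) = μ - ν := by ring
    rw [e1]
    have hp' : 0 < ‖(s : ℂ) - μ‖ := norm_pos_iff.2 hp
    have hq' : 0 < ‖(s : ℂ) - ν‖ := norm_pos_iff.2 hq
    have key : (‖(s : ℂ) - μ‖ * ‖(s : ℂ) - ν‖)⁻¹ ≤
        2⁻¹ * ((‖(s : ℂ) - μ‖ ^ 2)⁻¹ + (‖(s : ℂ) - ν‖ ^ 2)⁻¹) := by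
      rw [mul_inv, ← inv_pow, ← inv_pow]
      nlinarith [sq_nonneg (‖(s : ℂ) - μ‖⁻¹ - ‖(s : ℂ) - ν‖⁻¹)]
    calc ‖μ - ν‖ / (‖(s : ℂ) - μ‖ * ‖(s : ℂ) - ν‖)
        = ‖μ - ν‖ * (‖(s : ℂ) - μ‖ * ‖(s : ℂ) - ν‖)⁻¹ := div_eq_mul_inv _ _
      _ ≤ ‖μ - ν‖ * (2⁻¹ * ((‖(s : ℂ) - μ‖ ^ 2)⁻¹ + (‖(s : ℂ) - ν‖ ^ 2)⁻¹)) := by gcongr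
      _ = ‖μ - ν‖ / 2 * ((‖(s : ℂ) - μ‖ ^ 2)⁻¹ + (‖(s : ℂ) - ν‖ ^ 2)⁻¹) := by ring

/-- Little-o from a quadratic remainder bound: if `‖f(x + k) - f x - k • f'‖ ≤ C ‖k‖²` for small
`k`, then `f` has derivative `f'` at `x`. [folklore] -/
theorem hasDerivAt_of_norm_sub_sub_smul_le {E : Type*} [NormedAddCommGroup E] [NormedSpace ℂ E]
    {f : ℂ → E} {f' : E} {x : ℂ} {r C : ℝ} (hr : 0 < r)
    (h : ∀ k : ℂ, ‖k‖ < r → ‖f (x + k) - f x - k • f'‖ ≤ C * ‖k‖ ^ 2) : HasDerivAt f f' x := by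
  rw [hasDerivAt_iff_isLittleO_nhds_zero, Asymptotics.isLittleO_iff]
  intro c hc
  have hC : 0 < max C 0 + 1 := by positivity
  have hδ : 0 < min r (c / (max C 0 + 1)) := lt_min hr (div_pos hc hC)
  filter_upwards [Metric.ball_mem_nhds (0 : ℂ) hδ] with k hk
  rw [Metric.mem_ball, dist_zero_right, lt_min_iff] at hk
  calc ‖f (x + k) - f x - k • f'‖ ≤ C * ‖k‖ ^ 2 := h k hk.1
    _ ≤ (max C 0 + 1) * ‖k‖ * ‖k‖ := by
        rw [sq, ← mul_assoc]
        gcongr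
        linarith [le_max_left C 0]
    _ ≤ (max C 0 + 1) * (c / (max C 0 + 1)) * ‖k‖ := by
        gcongr
        exact hk.2.le
    _ = c * ‖k‖ := by field_simp

/-! ### The Poisson smearing `W(w) x = ∫ (π(1+u²))⁻¹ T(Re w + u Im w) x du` -/

section Poisson

variable (T : OneParameterUnitaryGroup H)

/-- The Poisson weight `(π (1 + u²))⁻¹` is positive. [folklore] -/
theorem poissonWeight_pos (u : ℝ) : 0 < (Real.pi * (1 + u ^ 2))⁻¹ := by positivity

/-- The Poisson weight integrates to `1`. [folklore] -/
theorem integral_poissonWeight : ∫ u : ℝ, (Real.pi * (1 + u ^ 2))⁻¹ = 1 := by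
  simp_rw [mul_inv]
  rw [integral_const_mul, integral_univ_inv_one_add_sq, inv_mul_cancel₀ Real.pi_ne_zero]

/-- The Poisson weight is integrable. [folklore] -/
theorem integrable_poissonWeight : Integrable fun u : ℝ => (Real.pi * (1 + u ^ 2))⁻¹ := by
  simp_rw [mul_inv]
  exact integrable_inv_one_add_sq.const_mul _

/-- The Poisson weight, as a complex-valued kernel, is integrable. [folklore] -/
theorem integrable_poissonWeight_complex :
    Integrable fun u : ℝ => (((Real.pi * (1 + u ^ 2))⁻¹ : ℝ) : ℂ) :=
  integrable_poissonWeight.ofReal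

/-- The Poisson-smeared orbit `u ↦ (π(1+u²))⁻¹ • T(a + b u) x` is integrable. [folklore] -/
theorem integrable_poissonWeight_smul_appReal (a b : ℝ) (x : H) :
    Integrable fun u : ℝ => (((Real.pi * (1 + u ^ 2))⁻¹ : ℝ) : ℂ) • T.appReal (a + b * u) x := by
  refine (integrable_poissonWeight_complex.norm.mul_const ‖x‖).mono'
    (integrable_poissonWeight_complex.aestronglyMeasurable.smul
      ((T.continuous_appReal_apply x).comp
        (continuous_const.add (continuous_const.mul continuous_id))).aestronglyMeasurable)
    (Eventually.of_forall fun u => ?_)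
  rw [norm_smul, norm_appReal]

/-- `‖∫ (π(1+u²))⁻¹ • T(a + bu) x du‖ ≤ ‖x‖`. [folklore] -/
theorem norm_integral_poissonWeight_smul_appReal_le (a b : ℝ) (x : H) :
    ‖∫ u : ℝ, (((Real.pi * (1 + u ^ 2))⁻¹ : ℝ) : ℂ) • T.appReal (a + b * u) x‖ ≤ ‖x‖ := by
  calc ‖∫ u : ℝ, (((Real.pi * (1 + u ^ 2))⁻¹ : ℝ) : ℂ) • T.appReal (a + b * u) x‖
      ≤ ∫ u : ℝ, ‖(((Real.pi * (1 + u ^ 2))⁻¹ : ℝ) : ℂ) • T.appReal (a + b * u) x‖ :=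
        norm_integral_le_integral_norm _
    _ = ∫ u : ℝ, (Real.pi * (1 + u ^ 2))⁻¹ * ‖x‖ := by
        refine integral_congr_ae (Eventually.of_forall fun u => ?_)
        simp only
        rw [norm_smul, norm_appReal, Complex.norm_real, Real.norm_eq_abs,
          abs_of_pos (poissonWeight_pos u)]
    _ = ‖x‖ := by rw [integral_mul_const, integral_poissonWeight, one_mul]

/-- **The Poisson-smeared operators exist as bounded operators**: there is `W : ℂ → (H →L[ℂ] H)` with
`W(w) x = ∫ (π(1+u²))⁻¹ T(Re w + u Im w) x du` (stated existentially; no definition is introduced).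
[folklore] -/
theorem exists_poissonExtension :
    ∃ W : ℂ → (H →L[ℂ] H), ∀ (w : ℂ) (x : H),
      W w x = ∫ u : ℝ, (((Real.pi * (1 + u ^ 2))⁻¹ : ℝ) : ℂ) • T.appReal (w.re + w.im * u) x := by
  refine ⟨fun w => LinearMap.mkContinuous
    { toFun := fun x =>
        ∫ u : ℝ, (((Real.pi * (1 + u ^ 2))⁻¹ : ℝ) : ℂ) • T.appReal (w.re + w.im * u) x
      map_add' := fun x y => by
        rw [← integral_add (T.integrable_poissonWeight_smul_appReal w.re w.im x)
          (T.integrable_poissonWeight_smul_appReal w.re w.im y)]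
        simp_rw [map_add, smul_add]
      map_smul' := fun c x => by
        rw [RingHom.id_apply, ← integral_smul]
        simp_rw [map_smul, smul_comm _ c] } 1
    (fun x => by
      rw [one_mul]
      exact T.norm_integral_poissonWeight_smul_appReal_le w.re w.im x), fun w x => rfl⟩

variable {T}
variable {W : ℂ → (H →L[ℂ] H)}
  (hW : ∀ (w : ℂ) (x : H),
    W w x = ∫ u : ℝ, (((Real.pi * (1 + u ^ 2))⁻¹ : ℝ) : ℂ) • T.appReal (w.re + w.im * u) x)
include hW

/-- **Boundary values**: `W(s) = T(s)` for real `s`. [folklore] -/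
theorem poissonExtension_ofReal (s : ℝ) : W s = T.appReal s := by
  ext x
  rw [hW]
  simp only [ofReal_re, ofReal_im, zero_mul, add_zero]
  rw [integral_smul_const, integral_complex_ofReal, integral_poissonWeight, ofReal_one, one_smul]

/-- **Contractivity**: `‖W(w) x‖ ≤ ‖x‖`. [folklore] -/
theorem norm_poissonExtension_apply_le (w : ℂ) (x : H) : ‖W w x‖ ≤ ‖x‖ := by
  rw [hW]
  exact T.norm_integral_poissonWeight_smul_appReal_le w.re w.im x

/-- **Contractivity**: `‖W(w)‖ ≤ 1`. [folklore] -/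
theorem norm_poissonExtension_le (w : ℂ) : ‖W w‖ ≤ 1 :=
  ContinuousLinearMap.opNorm_le_bound _ zero_le_one fun x => by
    rw [one_mul]; exact norm_poissonExtension_apply_le hW w x

/-- **Strong continuity** of `w ↦ W(w) x` on all of `ℂ` (dominated convergence). [folklore] -/
theorem continuous_poissonExtension_apply (x : H) : Continuous fun w : ℂ => W w x := by
  have h : (fun w : ℂ => W w x) = fun w : ℂ =>
      ∫ u : ℝ, (((Real.pi * (1 + u ^ 2))⁻¹ : ℝ) : ℂ) • T.appReal (w.re + w.im * u) x := by
    funext w; exact hW w x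
  rw [h]
  refine continuous_of_dominated (bound := fun u => ‖(((Real.pi * (1 + u ^ 2))⁻¹ : ℝ) : ℂ)‖ * ‖x‖)
    (fun w => (T.integrable_poissonWeight_smul_appReal w.re w.im x).aestronglyMeasurable)
    (fun w => Eventually.of_forall fun u => by rw [norm_smul, norm_appReal])
    (integrable_poissonWeight_complex.norm.mul_const ‖x‖)
    (Eventually.of_forall fun u => ?_)
  have hc : Continuous fun w : ℂ => w.re + w.im * u := by fun_prop
  exact ((T.continuous_appReal_apply x).comp hc).const_smul _

/-- **Joint strong continuity** of `(w, x) ↦ W(w) x` (contractivity plus strong continuity).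
[folklore] -/
theorem continuous_poissonExtension_uncurry : Continuous fun p : ℂ × H => W p.1 p.2 := by
  refine continuous_iff_continuousAt.2 fun p => ?_
  have h1 : Tendsto (fun q : ℂ × H => W q.1 (q.2 - p.2)) (𝓝 p) (𝓝 0) := by
    rw [tendsto_zero_iff_norm_tendsto_zero]
    have h2 : Tendsto (fun q : ℂ × H => ‖q.2 - p.2‖) (𝓝 p) (𝓝 0) := by
      have : Continuous fun q : ℂ × H => ‖q.2 - p.2‖ := by fun_prop
      simpa using this.tendsto p
    exact squeeze_zero (fun q => norm_nonneg _)
      (fun q => norm_poissonExtension_apply_le hW q.1 (q.2 - p.2)) h2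
  have h3 : Tendsto (fun q : ℂ × H => W q.1 p.2) (𝓝 p) (𝓝 (W p.1 p.2)) :=
    ((continuous_poissonExtension_apply hW p.2).comp continuous_fst).tendsto p
  have h4 := h1.add h3
  simp only [zero_add] at h4
  refine h4.congr fun q => ?_
  simp only [map_sub, sub_add_cancel]

/-- **Poisson form** on the upper half-plane: for `Im w > 0`,
`W(w) x = ∫ (Im w / (π ((s - Re w)² + (Im w)²))) T(s) x ds` (substitution `s = Re w + u Im w`).
[folklore] -/
theorem poissonExtension_apply_eq_integral {w : ℂ} (hw : 0 < w.im) (x : H) :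
    W w x = ∫ s : ℝ,
      (((w.im / (Real.pi * ((s - w.re) ^ 2 + w.im ^ 2))) : ℝ) : ℂ) • T.appReal s x := by
  rw [hW]
  set a := w.re
  set b := w.im with hb_def
  set g : ℝ → H := fun s =>
    (((b / (Real.pi * ((s - a) ^ 2 + b ^ 2))) : ℝ) : ℂ) • T.appReal s x with hg
  have hb : b ≠ 0 := hw.ne'
  have key : ∀ u : ℝ, (((Real.pi * (1 + u ^ 2))⁻¹ : ℝ) : ℂ) • T.appReal (a + b * u) x =
      (b : ℂ) • g (a + b * u) := by
    intro u
    simp only [hg, smul_smul, add_sub_cancel_left]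
    rw [← ofReal_mul]
    congr 2
    have : Real.pi * ((b * u) ^ 2 + b ^ 2) ≠ 0 := by positivity
    field_simp
    ring
  simp_rw [key]
  rw [integral_smul, Measure.integral_comp_mul_left (fun v => g (a + v)) b,
    integral_add_left_eq_self g a, abs_of_pos (inv_pos.2 hw),
    ← Complex.coe_smul, smul_smul, ← ofReal_mul, mul_inv_cancel₀ hb,
    ofReal_one, one_smul]

end Poisson

/-! ### The key lemma: `∫ (s - μ)⁻² T(s) x ds = 0` for `Im μ < 0` -/

section Key

variable (T : OneParameterUnitaryGroup H)

/-- Translation of the second-order Cauchy smearing: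
`T(t) ∫ (s - μ)⁻² T(s)x ds = ∫ (s - μ - t)⁻² T(s)x ds`. [folklore] -/
theorem appReal_integral_inv_sq_smul_appReal {μ : ℂ} (hμ : μ.im ≠ 0) (x : H) (t : ℝ) :
    T.appReal t (∫ s : ℝ, (((s : ℂ) - μ) ^ 2)⁻¹ • T.appReal s x) =
      ∫ s : ℝ, (((s : ℂ) - (μ + t)) ^ 2)⁻¹ • T.appReal s x := by
  rw [T.appReal_apply_integral_smul_appReal (integrable_inv_ofReal_sub_sq hμ) x t]
  refine integral_congr_ae (Eventually.of_forall fun s => ?_)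
  simp only [ofReal_sub]
  congr 3
  ring

/-- `s ↦ 2 (s - μ)⁻³` is integrable for `Im μ ≠ 0`. [folklore] -/
theorem integrable_two_mul_inv_ofReal_sub_pow_three {μ : ℂ} (hμ : μ.im ≠ 0) :
    Integrable fun s : ℝ => 2 * (((s : ℂ) - μ) ^ 3)⁻¹ := by
  refine ((integrable_inv_sub_sq_add_sq μ.re hμ).const_mul (2 * (16 / |μ.im|))).mono' ?_
    (Eventually.of_forall fun s => ?_)
  · exact (continuous_const.mul (((continuous_ofReal.sub continuous_const).pow 3).inv₀
      (fun s => pow_ne_zero 3 (ofReal_sub_ne_zero hμ s)))).aestronglyMeasurable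
  · rw [norm_mul, Complex.norm_ofNat, mul_assoc]
    refine mul_le_mul_of_nonneg_left ?_ (by norm_num)
    exact norm_inv_ofReal_sub_pow_three_le hμ (by simpa using abs_pos.2 hμ) s

/-- **Second-order Taylor remainder of the Cauchy smearing**: for `Im μ ≠ 0` and `‖k‖ < |Im μ|/2`,
`‖Y(μ + k) - Y(μ) - k • Z(μ)‖ ≤ (16 π / |Im μ|³) ‖x‖ ‖k‖²`, where `Y(μ) = ∫ (s-μ)⁻² T(s)x ds` and
`Z(μ) = ∫ 2 (s-μ)⁻³ T(s)x ds` (from the pointwise identity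
`(c-k)⁻² - c⁻² - 2k c⁻³ = k²(3c - 2k)/(c³(c-k)²)`). [folklore] -/
theorem norm_integral_inv_sq_taylor_le {μ : ℂ} (hμ : μ.im ≠ 0) (x : H) {k : ℂ}
    (hk : ‖k‖ < |μ.im| / 2) :
    ‖(∫ s : ℝ, (((s : ℂ) - (μ + k)) ^ 2)⁻¹ • T.appReal s x) -
        (∫ s : ℝ, (((s : ℂ) - μ) ^ 2)⁻¹ • T.appReal s x) -
        k • ∫ s : ℝ, (2 * (((s : ℂ) - μ) ^ 3)⁻¹) • T.appReal s x‖ ≤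
      16 * Real.pi / |μ.im| ^ 3 * ‖x‖ * ‖k‖ ^ 2 := by
  have him0 : 0 < |μ.im| := abs_pos.2 hμ
  have hk' : ‖(μ + k) - μ‖ < |μ.im| / 2 := by simpa using hk
  have hμk : (μ + k).im ≠ 0 := by
    intro h0
    have h1 := (sq_add_sq_le_norm_sq_of_norm_sub_lt hk' 0).2
    rw [h0, abs_zero] at h1
    linarith
  have hI1 := T.integrable_smul_appReal (integrable_inv_ofReal_sub_sq hμk) x
  have hI2 := T.integrable_smul_appReal (integrable_inv_ofReal_sub_sq hμ) x
  have hI3 : Integrable fun s : ℝ => k • ((2 * (((s : ℂ) - μ) ^ 3)⁻¹) • T.appReal s x) :=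
    (T.integrable_smul_appReal (integrable_two_mul_inv_ofReal_sub_pow_three hμ) x).smul k
  have hI12 : Integrable fun s : ℝ => (((s : ℂ) - (μ + k)) ^ 2)⁻¹ • T.appReal s x -
      (((s : ℂ) - μ) ^ 2)⁻¹ • T.appReal s x := hI1.sub hI2
  rw [← integral_smul, ← integral_sub hI1 hI2, ← integral_sub hI12 hI3]
  -- pointwise identity
  have hpt : ∀ s : ℝ, (((s : ℂ) - (μ + k)) ^ 2)⁻¹ • T.appReal s x -
      (((s : ℂ) - μ) ^ 2)⁻¹ • T.appReal s x - k • ((2 * (((s : ℂ) - μ) ^ 3)⁻¹) • T.appReal s x) =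
      (k ^ 2 * (3 * ((s : ℂ) - μ) - 2 * k) *
        (((s : ℂ) - μ) ^ 3 * ((s : ℂ) - (μ + k)) ^ 2)⁻¹) • T.appReal s x := by
    intro s
    rw [smul_smul, ← sub_smul, ← sub_smul]
    congr 1
    have hc : (s : ℂ) - μ ≠ 0 := ofReal_sub_ne_zero hμ s
    have hck : (s : ℂ) - (μ + k) ≠ 0 := ofReal_sub_ne_zero hμk s
    field_simp
    ring
  simp_rw [hpt]
  -- pointwise bound
  have hbound : ∀ s : ℝ, ‖(k ^ 2 * (3 * ((s : ℂ) - μ) - 2 * k) *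
      (((s : ℂ) - μ) ^ 3 * ((s : ℂ) - (μ + k)) ^ 2)⁻¹) • T.appReal s x‖ ≤
      16 / |μ.im| ^ 2 * ‖x‖ * ‖k‖ ^ 2 * ((s - μ.re) ^ 2 + μ.im ^ 2)⁻¹ := by
    intro s
    have hc : (s : ℂ) - μ ≠ 0 := ofReal_sub_ne_zero hμ s
    have hcpos : 0 < ‖(s : ℂ) - μ‖ := norm_pos_iff.2 hc
    have him : |μ.im| ≤ ‖(s : ℂ) - μ‖ := abs_im_le_norm_ofReal_sub s μ
    have hkc : ‖k‖ ≤ ‖(s : ℂ) - μ‖ / 2 := by linarith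
    -- `‖s - μ - k‖ ≥ ‖s - μ‖ / 2`
    have hck : ‖(s : ℂ) - μ‖ / 2 ≤ ‖(s : ℂ) - (μ + k)‖ := by
      have e : (s : ℂ) - (μ + k) = ((s : ℂ) - μ) - k := by ring
      rw [e]
      have := norm_sub_norm_le ((s : ℂ) - μ) k
      linarith
    have h3c : ‖3 * ((s : ℂ) - μ) - 2 * k‖ ≤ 4 * ‖(s : ℂ) - μ‖ := by
      calc ‖3 * ((s : ℂ) - μ) - 2 * k‖ ≤ ‖3 * ((s : ℂ) - μ)‖ + ‖2 * k‖ := norm_sub_le _ _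
        _ = 3 * ‖(s : ℂ) - μ‖ + 2 * ‖k‖ := by
            rw [norm_mul, norm_mul, Complex.norm_ofNat, Complex.norm_ofNat]
        _ ≤ 4 * ‖(s : ℂ) - μ‖ := by linarith
    rw [norm_smul, norm_appReal, norm_mul, norm_mul, norm_pow, norm_inv, norm_mul, norm_pow,
      norm_pow, ← norm_sq_ofReal_sub]
    have hden : ‖(s : ℂ) - μ‖ ^ 3 * (‖(s : ℂ) - μ‖ / 2) ^ 2 ≤
        ‖(s : ℂ) - μ‖ ^ 3 * ‖(s : ℂ) - (μ + k)‖ ^ 2 := by gcongr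
    have hden0 : 0 < ‖(s : ℂ) - μ‖ ^ 3 * (‖(s : ℂ) - μ‖ / 2) ^ 2 := by positivity
    calc ‖k‖ ^ 2 * ‖3 * ((s : ℂ) - μ) - 2 * k‖ *
          (‖(s : ℂ) - μ‖ ^ 3 * ‖(s : ℂ) - (μ + k)‖ ^ 2)⁻¹ * ‖x‖
        ≤ ‖k‖ ^ 2 * (4 * ‖(s : ℂ) - μ‖) *
          (‖(s : ℂ) - μ‖ ^ 3 * (‖(s : ℂ) - μ‖ / 2) ^ 2)⁻¹ * ‖x‖ := by
          have := inv_anti₀ hden0 hden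
          gcongr
      _ = 16 * (‖(s : ℂ) - μ‖⁻¹) ^ 2 * ‖x‖ * ‖k‖ ^ 2 * (‖(s : ℂ) - μ‖ ^ 2)⁻¹ := by
          field_simp
          ring
      _ ≤ 16 * (|μ.im|⁻¹) ^ 2 * ‖x‖ * ‖k‖ ^ 2 * (‖(s : ℂ) - μ‖ ^ 2)⁻¹ := by
          have := inv_anti₀ him0 him
          gcongr
      _ = 16 / |μ.im| ^ 2 * ‖x‖ * ‖k‖ ^ 2 * (‖(s : ℂ) - μ‖ ^ 2)⁻¹ := by
          rw [inv_pow, div_eq_mul_inv]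
  refine (norm_integral_le_of_norm_le
    ((integrable_inv_sub_sq_add_sq μ.re hμ).const_mul (16 / |μ.im| ^ 2 * ‖x‖ * ‖k‖ ^ 2))
    (Eventually.of_forall hbound)).trans (le_of_eq ?_)
  rw [integral_const_mul, ← sq_abs μ.im, integral_inv_sub_sq_add_sq μ.re him0]
  field_simp

/-- **The Cauchy smearing is holomorphic off the real axis**: for `Im μ ≠ 0`,
`d/dν ∫ (s - ν)⁻² T(s)x ds |_{ν = μ} = ∫ 2(s - μ)⁻³ T(s)x ds`. [folklore] -/
theorem hasDerivAt_integral_inv_sq_smul_appReal {μ : ℂ} (hμ : μ.im ≠ 0) (x : H) :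
    HasDerivAt (fun ν : ℂ => ∫ s : ℝ, (((s : ℂ) - ν) ^ 2)⁻¹ • T.appReal s x)
      (∫ s : ℝ, (2 * (((s : ℂ) - μ) ^ 3)⁻¹) • T.appReal s x) μ :=
  hasDerivAt_of_norm_sub_sub_smul_le (half_pos (abs_pos.2 hμ)) fun _ hk =>
    T.norm_integral_inv_sq_taylor_le hμ x hk

/-- **The Cauchy smearing lies in the domain of the generator**: for `Im μ ≠ 0`,
`∫ (s - μ)⁻² T(s)x ds ∈ D(A)` with `A ∫ (s - μ)⁻² T(s)x ds = ∫ 2(s - μ)⁻³ T(s)x ds` (the orbit is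
`t ↦ Y(μ + t)`, differentiable by holomorphy of `Y`; Reed–Simon I, Thm. VIII.7).
[cite: ReedSimonI1980, Thm. VIII.7] -/
theorem integral_inv_sq_smul_appReal_mem_generator_domain {μ : ℂ} (hμ : μ.im ≠ 0) (x : H) :
    ∃ h : (∫ s : ℝ, (((s : ℂ) - μ) ^ 2)⁻¹ • T.appReal s x) ∈
        (OneParameterGroup.generator T.toStrongContRepresentation).domain,
      OneParameterGroup.generator T.toStrongContRepresentation ⟨_, h⟩ =
        ∫ s : ℝ, (2 * (((s : ℂ) - μ) ^ 3)⁻¹) • T.appReal s x := by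
  apply OneParameterGroup.mem_generator_domain_of_hasDerivAt
  have hY : (fun t : ℝ => OneParameterGroup.app T.toStrongContRepresentation t
      (∫ s : ℝ, (((s : ℂ) - μ) ^ 2)⁻¹ • T.appReal s x)) =
      fun t : ℝ => ∫ s : ℝ, (((s : ℂ) - (μ + t)) ^ 2)⁻¹ • T.appReal s x := by
    funext t
    rw [app_toStrongContRepresentation]
    exact T.appReal_integral_inv_sq_smul_appReal hμ x t
  rw [hY]
  have h1 : HasDerivAt (fun ν : ℂ => ∫ s : ℝ, (((s : ℂ) - ν) ^ 2)⁻¹ • T.appReal s x)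
      (∫ s : ℝ, (2 * (((s : ℂ) - μ) ^ 3)⁻¹) • T.appReal s x) (μ + ((0 : ℝ) : ℂ)) := by
    simpa using T.hasDerivAt_integral_inv_sq_smul_appReal hμ x
  have h2 : HasDerivAt (fun t : ℝ => μ + (t : ℂ)) 1 0 := by
    simpa using (Complex.ofRealCLM.hasDerivAt (x := (0 : ℝ))).const_add μ
  have h3 := h1.scomp (0 : ℝ) h2
  simpa [Function.comp_def] using h3

/-- **Key lemma, vertical-line form**: if `T` has positive energy then
`∫ (s - a + ib)⁻² T(s) x ds = 0` for `b > 0`. With `y(b)` this integral: `y(b) ∈ D(P)`,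
`y'(b) = P y(b)`, so `‖y‖²` is non-decreasing on `(0, ∞)` (`(‖y‖²)' = 2⟪y, Py⟫ ≥ 0`), while
`‖y(b)‖ ≤ π‖x‖/b → 0`. [folklore] -/
theorem integral_inv_sq_smul_appReal_eq_zero_aux (hT : T.HasPositiveEnergy) (a : ℝ) (x : H)
    {b : ℝ} (hb : 0 < b) :
    ∫ s : ℝ, (((s : ℂ) - ((a : ℂ) - (b : ℂ) * I)) ^ 2)⁻¹ • T.appReal s x = 0 := by
  -- notation (local abbreviations only)
  set Y : ℂ → H := fun μ => ∫ s : ℝ, (((s : ℂ) - μ) ^ 2)⁻¹ • T.appReal s x with hY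
  set Z : ℂ → H := fun μ => ∫ s : ℝ, (2 * (((s : ℂ) - μ) ^ 3)⁻¹) • T.appReal s x with hZ
  set m : ℝ → ℂ := fun b => (a : ℂ) - (b : ℂ) * I with hm
  have him : ∀ b : ℝ, (m b).im = -b := fun b => by simp [hm]
  have him0 : ∀ b : ℝ, 0 < b → (m b).im ≠ 0 := fun b hb => by rw [him]; linarith
  change Y (m b) = 0
  -- derivative of `b ↦ Y (m b)`
  have hderiv : ∀ b : ℝ, 0 < b → HasDerivAt (fun b : ℝ => Y (m b)) ((-I) • Z (m b)) b := by
    intro b hb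
    have h1 : HasDerivAt Y (Z (m b)) (m b) :=
      T.hasDerivAt_integral_inv_sq_smul_appReal (him0 b hb) x
    have h2 : HasDerivAt m (-I) b := by
      have := ((Complex.ofRealCLM.hasDerivAt (x := b)).mul_const I).const_sub (a : ℂ)
      simpa [hm] using this
    exact h1.scomp b h2
  -- domain and Hamiltonian: `P (Y (m b)) = -i • Z (m b)`
  have hdom : ∀ b : ℝ, 0 < b → ∃ h : Y (m b) ∈ T.hamiltonian.domain,
      T.hamiltonian ⟨Y (m b), h⟩ = (-I) • Z (m b) := by
    intro b hb
    obtain ⟨h, hA⟩ := T.integral_inv_sq_smul_appReal_mem_generator_domain (him0 b hb) x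
    refine ⟨h, ?_⟩
    rw [hamiltonian_apply]
    exact congrArg (fun v => (-Complex.I) • v) hA
  -- derivative of `‖Y (m b)‖²`
  have hsq : ∀ b : ℝ, 0 < b →
      HasDerivAt (fun b : ℝ => ‖Y (m b)‖ ^ 2) (2 * (⟪Y (m b), (-I) • Z (m b)⟫_ℂ).re) b := by
    intro b hb
    have h1 := (hderiv b hb).inner ℂ (hderiv b hb)
    have h2 : HasDerivAt (fun b : ℝ => (⟪Y (m b), Y (m b)⟫_ℂ).re)
        ((⟪Y (m b), (-I) • Z (m b)⟫_ℂ + ⟪(-I) • Z (m b), Y (m b)⟫_ℂ).re) b :=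
      Complex.reCLM.hasFDerivAt.comp_hasDerivAt b h1
    have h3 : (fun b : ℝ => ‖Y (m b)‖ ^ 2) = fun b : ℝ => (⟪Y (m b), Y (m b)⟫_ℂ).re := by
      funext b
      rw [← inner_self_eq_norm_sq (𝕜 := ℂ)]
      rfl
    rw [h3]
    convert h2 using 1
    rw [add_re, ← inner_conj_symm (Y (m b)) ((-I) • Z (m b)), conj_re, two_mul]
  have hsq_nonneg : ∀ b : ℝ, 0 < b → 0 ≤ 2 * (⟪Y (m b), (-I) • Z (m b)⟫_ℂ).re := by
    intro b hb
    obtain ⟨h, hP⟩ := hdom b hb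
    have := hT.2 ⟨Y (m b), h⟩
    rw [hP] at this
    have h' : 0 ≤ (⟪Y (m b), (-I) • Z (m b)⟫_ℂ).re := by simpa using this
    linarith
  -- `‖Y (m b)‖²` is non-decreasing on `(0, ∞)`
  have hmono : MonotoneOn (fun b : ℝ => ‖Y (m b)‖ ^ 2) (Ioi 0) := by
    refine monotoneOn_of_deriv_nonneg (convex_Ioi 0) ?_ ?_ ?_
    · exact fun b hb => (hsq b hb).continuousAt.continuousWithinAt
    · rw [interior_Ioi]
      exact fun b hb => (hsq b hb).differentiableAt.differentiableWithinAt
    · rw [interior_Ioi]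
      intro b hb
      rw [(hsq b hb).deriv]
      exact hsq_nonneg b hb
  -- the a priori bound `‖Y (m b)‖ ≤ π ‖x‖ / b`
  have hbound : ∀ b : ℝ, 0 < b → ‖Y (m b)‖ ≤ Real.pi / b * ‖x‖ := by
    intro b hb
    have := T.norm_integral_smul_appReal_le (fun s : ℝ => (((s : ℂ) - m b) ^ 2)⁻¹) x
    rw [integral_norm_inv_ofReal_sub_sq (him0 b hb), him, abs_neg, abs_of_pos hb] at this
    exact this
  -- conclusion
  have hlim : Tendsto (fun B : ℝ => (Real.pi / B * ‖x‖) ^ 2) atTop (𝓝 0) := by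
    have h1 : Tendsto (fun B : ℝ => Real.pi / B * ‖x‖) atTop (𝓝 0) := by
      have := (tendsto_const_nhds (x := Real.pi)).div_atTop tendsto_id
      simpa using this.mul_const ‖x‖
    simpa using h1.pow 2
  have hle : ‖Y (m b)‖ ^ 2 ≤ 0 := by
    refine ge_of_tendsto hlim ?_
    filter_upwards [eventually_ge_atTop b] with B hB
    have hB0 : 0 < B := hb.trans_le hB
    calc ‖Y (m b)‖ ^ 2 ≤ ‖Y (m B)‖ ^ 2 := hmono hb hB0 hB
      _ ≤ (Real.pi / B * ‖x‖) ^ 2 := by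
          gcongr
          exact hbound B hB0
  have : ‖Y (m b)‖ = 0 := by nlinarith [norm_nonneg (Y (m b))]
  exact norm_eq_zero.1 this

/-- **Key lemma**: if `T` has positive energy then **`∫ (s - μ)⁻² T(s) x ds = 0` for `Im μ < 0`**
(the elementary substitute for "the spectral measure of `P` is supported in `[0, ∞)`": for
`T(s) = e^{isλ}`, `λ ≥ 0`, close the contour in the upper half-plane). [folklore] -/
theorem integral_inv_sq_smul_appReal_eq_zero (hT : T.HasPositiveEnergy) {μ : ℂ} (hμ : μ.im < 0)
    (x : H) : ∫ s : ℝ, (((s : ℂ) - μ) ^ 2)⁻¹ • T.appReal s x = 0 := by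
  have e : μ = (μ.re : ℂ) - ((-μ.im : ℝ) : ℂ) * I := by
    apply Complex.ext <;> simp
  rw [e]
  exact T.integral_inv_sq_smul_appReal_eq_zero_aux hT μ.re x (by linarith)

/-! ### The first-order Cauchy smearing `∫ ((s - ν)⁻¹ - (s + i)⁻¹) T(s) x ds` -/

/-- Integrability of the regularised Cauchy kernel `(s - ν)⁻¹ - (s + i)⁻¹`, `Im ν ≠ 0`. [folklore] -/
theorem integrable_inv_ofReal_sub_sub_inv_add_I {ν : ℂ} (hν : ν.im ≠ 0) :
    Integrable fun s : ℝ => ((s : ℂ) - ν)⁻¹ - ((s : ℂ) + I)⁻¹ := by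
  have e1 : ∀ s : ℝ, (s : ℂ) + I = (s : ℂ) - (-I) := fun s => by ring
  simp_rw [e1]
  exact integrable_inv_ofReal_sub_sub_inv hν (by simp)

/-- **Second-order Taylor remainder of the first-order Cauchy smearing**: for `Im ν ≠ 0` and
`‖k‖ < |Im ν|/2`, `‖n(ν + k) - n(ν) - k • Y(ν)‖ ≤ (2π/|Im ν|²) ‖x‖ ‖k‖²`, where
`n(ν) = ∫ ((s-ν)⁻¹ - (s+i)⁻¹) T(s)x ds`, `Y(ν) = ∫ (s-ν)⁻² T(s)x ds` (pointwise identity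
`(c-k)⁻¹ - c⁻¹ - k c⁻² = k²/((c-k)c²)`). [folklore] -/
theorem norm_integral_inv_sub_inv_taylor_le {ν : ℂ} (hν : ν.im ≠ 0) (x : H) {k : ℂ}
    (hk : ‖k‖ < |ν.im| / 2) :
    ‖(∫ s : ℝ, (((s : ℂ) - (ν + k))⁻¹ - ((s : ℂ) + I)⁻¹) • T.appReal s x) -
        (∫ s : ℝ, (((s : ℂ) - ν)⁻¹ - ((s : ℂ) + I)⁻¹) • T.appReal s x) -
        k • ∫ s : ℝ, (((s : ℂ) - ν) ^ 2)⁻¹ • T.appReal s x‖ ≤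
      2 * Real.pi / |ν.im| ^ 2 * ‖x‖ * ‖k‖ ^ 2 := by
  have him0 : 0 < |ν.im| := abs_pos.2 hν
  have hk' : ‖(ν + k) - ν‖ < |ν.im| / 2 := by simpa using hk
  have hνk : (ν + k).im ≠ 0 := by
    intro h0
    have h1 := (sq_add_sq_le_norm_sq_of_norm_sub_lt hk' 0).2
    rw [h0, abs_zero] at h1
    linarith
  have hI1 := T.integrable_smul_appReal (integrable_inv_ofReal_sub_sub_inv_add_I hνk) x
  have hI2 := T.integrable_smul_appReal (integrable_inv_ofReal_sub_sub_inv_add_I hν) x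
  have hI3 : Integrable fun s : ℝ => k • ((((s : ℂ) - ν) ^ 2)⁻¹ • T.appReal s x) :=
    (T.integrable_smul_appReal (integrable_inv_ofReal_sub_sq hν) x).smul k
  have hI12 : Integrable fun s : ℝ => (((s : ℂ) - (ν + k))⁻¹ - ((s : ℂ) + I)⁻¹) • T.appReal s x -
      (((s : ℂ) - ν)⁻¹ - ((s : ℂ) + I)⁻¹) • T.appReal s x := hI1.sub hI2
  rw [← integral_smul, ← integral_sub hI1 hI2, ← integral_sub hI12 hI3]
  have hpt : ∀ s : ℝ, (((s : ℂ) - (ν + k))⁻¹ - ((s : ℂ) + I)⁻¹) • T.appReal s x -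
      (((s : ℂ) - ν)⁻¹ - ((s : ℂ) + I)⁻¹) • T.appReal s x - k • ((((s : ℂ) - ν) ^ 2)⁻¹ • T.appReal s x) =
      (k ^ 2 * (((s : ℂ) - (ν + k)) * ((s : ℂ) - ν) ^ 2)⁻¹) • T.appReal s x := by
    intro s
    rw [smul_smul, ← sub_smul, ← sub_smul]
    congr 1
    have hc : (s : ℂ) - ν ≠ 0 := ofReal_sub_ne_zero hν s
    have hck : (s : ℂ) - (ν + k) ≠ 0 := ofReal_sub_ne_zero hνk s
    have hcI : (s : ℂ) + I ≠ 0 := by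
      rw [show (s : ℂ) + I = (s : ℂ) - (-I) by ring]; exact ofReal_sub_ne_zero (by simp) s
    field_simp
    ring
  simp_rw [hpt]
  have hbound : ∀ s : ℝ, ‖(k ^ 2 * (((s : ℂ) - (ν + k)) * ((s : ℂ) - ν) ^ 2)⁻¹) • T.appReal s x‖ ≤
      2 / |ν.im| * ‖x‖ * ‖k‖ ^ 2 * ((s - ν.re) ^ 2 + ν.im ^ 2)⁻¹ := by
    intro s
    have hc : (s : ℂ) - ν ≠ 0 := ofReal_sub_ne_zero hν s
    have hcpos : 0 < ‖(s : ℂ) - ν‖ := norm_pos_iff.2 hc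
    rw [norm_smul, norm_appReal, norm_mul, norm_pow, norm_inv, norm_mul, norm_pow,
      ← norm_sq_ofReal_sub, mul_inv]
    have h1 : ‖((s : ℂ) - (ν + k))‖⁻¹ ≤ 2 / |ν.im| := by
      rw [← norm_inv]; exact norm_inv_ofReal_sub_le hν hk' s
    calc ‖k‖ ^ 2 * (‖(s : ℂ) - (ν + k)‖⁻¹ * (‖(s : ℂ) - ν‖ ^ 2)⁻¹) * ‖x‖
        ≤ ‖k‖ ^ 2 * (2 / |ν.im| * (‖(s : ℂ) - ν‖ ^ 2)⁻¹) * ‖x‖ := by gcongr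
      _ = 2 / |ν.im| * ‖x‖ * ‖k‖ ^ 2 * (‖(s : ℂ) - ν‖ ^ 2)⁻¹ := by ring
  refine (norm_integral_le_of_norm_le
    ((integrable_inv_sub_sq_add_sq ν.re hν).const_mul (2 / |ν.im| * ‖x‖ * ‖k‖ ^ 2))
    (Eventually.of_forall hbound)).trans (le_of_eq ?_)
  rw [integral_const_mul, ← sq_abs ν.im, integral_inv_sub_sq_add_sq ν.re him0]
  field_simp

/-- The first-order Cauchy smearing is holomorphic off the real axis, with derivative the
second-order one. [folklore] -/
theorem hasDerivAt_integral_inv_sub_inv_smul_appReal {ν : ℂ} (hν : ν.im ≠ 0) (x : H) :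
    HasDerivAt (fun ν : ℂ => ∫ s : ℝ, (((s : ℂ) - ν)⁻¹ - ((s : ℂ) + I)⁻¹) • T.appReal s x)
      (∫ s : ℝ, (((s : ℂ) - ν) ^ 2)⁻¹ • T.appReal s x) ν :=
  hasDerivAt_of_norm_sub_sub_smul_le (half_pos (abs_pos.2 hν)) fun _ hk =>
    T.norm_integral_inv_sub_inv_taylor_le hν x hk

/-- **The regularised Cauchy smearing vanishes on the lower half-plane**: if `T` has positive
energy then `∫ ((s - ν)⁻¹ - (s + i)⁻¹) T(s) x ds = 0` for `Im ν < 0` (its `ν`-derivative vanishes by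
`integral_inv_sq_smul_appReal_eq_zero`, the lower half-plane is connected, and the value at
`ν = -i` is `0`). [folklore] -/
theorem integral_inv_sub_inv_smul_appReal_eq_zero (hT : T.HasPositiveEnergy) {ν : ℂ}
    (hν : ν.im < 0) (x : H) :
    ∫ s : ℝ, (((s : ℂ) - ν)⁻¹ - ((s : ℂ) + I)⁻¹) • T.appReal s x = 0 := by
  set n : ℂ → H := fun ν => ∫ s : ℝ, (((s : ℂ) - ν)⁻¹ - ((s : ℂ) + I)⁻¹) • T.appReal s x with hn
  have hd : ∀ ν : ℂ, ν.im < 0 → HasDerivAt n 0 ν := by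
    intro ν hν
    have := T.hasDerivAt_integral_inv_sub_inv_smul_appReal hν.ne x
    rwa [T.integral_inv_sq_smul_appReal_eq_zero hT hν x] at this
  have hopen : IsOpen {ν : ℂ | ν.im < 0} := isOpen_lt continuous_im continuous_const
  have hconn : IsPreconnected {ν : ℂ | ν.im < 0} := (convex_halfSpace_im_lt 0).isPreconnected
  have hdiff : DifferentiableOn ℂ n {ν : ℂ | ν.im < 0} := fun ν hν =>
    (hd ν hν).differentiableAt.differentiableWithinAt
  have hderiv : {ν : ℂ | ν.im < 0}.EqOn (deriv n) 0 := fun ν hν => (hd ν hν).deriv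
  have hI : (-I : ℂ) ∈ {ν : ℂ | ν.im < 0} := by simp
  have key := hopen.is_const_of_deriv_eq_zero hconn hdiff hderiv hν hI
  change n ν = 0
  rw [key]
  simp [hn, sub_neg_eq_add]

end Key

/-! ### Holomorphy of the Poisson extension on the upper half-plane -/

section Holomorphy

variable {T : OneParameterUnitaryGroup H}
variable {W : ℂ → (H →L[ℂ] H)}
  (hW : ∀ (w : ℂ) (x : H),
    W w x = ∫ u : ℝ, (((Real.pi * (1 + u ^ 2))⁻¹ : ℝ) : ℂ) • T.appReal (w.re + w.im * u) x)
include hW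

omit hW in
/-- **The Poisson kernel through Cauchy kernels**:
`Im w / (π((s - Re w)² + (Im w)²)) = (2πi)⁻¹ ((s - w)⁻¹ - (s - w̄)⁻¹)`. [folklore] -/
theorem poissonKernel_eq_inv_sub_inv {w : ℂ} (hw : w.im ≠ 0) (s : ℝ) :
    (((w.im / (Real.pi * ((s - w.re) ^ 2 + w.im ^ 2))) : ℝ) : ℂ) =
      (2 * Real.pi * I)⁻¹ * (((s : ℂ) - w)⁻¹ - ((s : ℂ) - conj w)⁻¹) := by
  have h1 : (s : ℂ) - w ≠ 0 := ofReal_sub_ne_zero hw s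
  have h2 : (s : ℂ) - conj w ≠ 0 := ofReal_sub_ne_zero (by simpa using hw) s
  have hprod : ((s : ℂ) - w) * ((s : ℂ) - conj w) = (((s - w.re) ^ 2 + w.im ^ 2 : ℝ) : ℂ) := by
    have : (s : ℂ) - conj w = conj ((s : ℂ) - w) := by rw [map_sub, conj_ofReal]
    rw [this, mul_conj, Complex.normSq_eq_norm_sq, norm_sq_ofReal_sub]
  have hdiff : ((s : ℂ) - conj w) - ((s : ℂ) - w) = ((2 * w.im : ℝ) : ℂ) * I := by
    rw [sub_sub_sub_cancel_left, sub_conj]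
  rw [inv_sub_inv h1 h2, hdiff, hprod]
  have hD : ((s - w.re) ^ 2 + w.im ^ 2 : ℝ) ≠ 0 := by positivity
  have hD' : (((s - w.re) ^ 2 + w.im ^ 2 : ℝ) : ℂ) ≠ 0 := ofReal_ne_zero.2 hD
  have hπ : (Real.pi : ℂ) ≠ 0 := ofReal_ne_zero.2 Real.pi_ne_zero
  have hI : (I : ℂ) ≠ 0 := I_ne_zero
  push_cast
  field_simp

/-- **Cauchy form of the Poisson extension**: if `T` has positive energy then, for `Im w > 0`,
`W(w) x = (2πi)⁻¹ ∫ ((s - w)⁻¹ - (s + i)⁻¹) T(s) x ds` (the anti-holomorphic part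
`(2πi)⁻¹ ∫ ((s - w̄)⁻¹ - (s + i)⁻¹) T(s)x ds` vanishes). [folklore] -/
theorem poissonExtension_apply_eq_cauchy (hT : T.HasPositiveEnergy) {w : ℂ} (hw : 0 < w.im)
    (x : H) :
    W w x = (2 * Real.pi * I)⁻¹ • ∫ s : ℝ, (((s : ℂ) - w)⁻¹ - ((s : ℂ) + I)⁻¹) • T.appReal s x := by
  rw [poissonExtension_apply_eq_integral hW hw x]
  have hw' : w.im ≠ 0 := hw.ne'
  have hcw : (conj w).im < 0 := by simpa using hw
  have hK := integrable_inv_ofReal_sub_sub_inv_add_I hw'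
  have hN := integrable_inv_ofReal_sub_sub_inv_add_I hcw.ne
  have hsplit : ∀ s : ℝ,
      (((w.im / (Real.pi * ((s - w.re) ^ 2 + w.im ^ 2))) : ℝ) : ℂ) • T.appReal s x =
      (2 * Real.pi * I)⁻¹ • ((((s : ℂ) - w)⁻¹ - ((s : ℂ) + I)⁻¹) • T.appReal s x) -
      (2 * Real.pi * I)⁻¹ • ((((s : ℂ) - conj w)⁻¹ - ((s : ℂ) + I)⁻¹) • T.appReal s x) := by
    intro s
    rw [poissonKernel_eq_inv_sub_inv hw' s, smul_smul, smul_smul, ← sub_smul]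
    congr 1
    ring
  simp_rw [hsplit]
  have hK' : Integrable fun s : ℝ =>
      (2 * Real.pi * I)⁻¹ • ((((s : ℂ) - w)⁻¹ - ((s : ℂ) + I)⁻¹) • T.appReal s x) :=
    (T.integrable_smul_appReal hK x).smul _
  have hN' : Integrable fun s : ℝ =>
      (2 * Real.pi * I)⁻¹ • ((((s : ℂ) - conj w)⁻¹ - ((s : ℂ) + I)⁻¹) • T.appReal s x) :=
    (T.integrable_smul_appReal hN x).smul _
  rw [integral_sub hK' hN', integral_smul, integral_smul,
    T.integral_inv_sub_inv_smul_appReal_eq_zero hT hcw x, smul_zero, sub_zero]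

/-- **The Poisson extension is holomorphic in operator norm on the upper half-plane**: for
`Im w₀ > 0`, `w ↦ W(w)` has derivative `(2πi)⁻¹ ∫ (s - w₀)⁻² T(s) · ds` at `w₀` in `H →L[ℂ] H`
(explicit remainder `‖W(w₀+k) - W(w₀) - k S‖ ≤ ‖k‖²/(Im w₀)²`). [folklore] -/
theorem hasDerivAt_poissonExtension (hT : T.HasPositiveEnergy) {w₀ : ℂ} (hw₀ : 0 < w₀.im) :
    ∃ S : H →L[ℂ] H, HasDerivAt W S w₀ := by
  obtain ⟨S, hS⟩ := T.exists_clm_integral_smul_appReal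
    ((integrable_inv_ofReal_sub_sq hw₀.ne').const_mul ((2 * Real.pi * I)⁻¹))
  refine ⟨S, hasDerivAt_of_norm_sub_sub_smul_le (r := w₀.im / 2) (C := (w₀.im ^ 2)⁻¹)
    (half_pos hw₀) fun k hk => ?_⟩
  have habs : |w₀.im| = w₀.im := abs_of_pos hw₀
  have hk' : ‖(w₀ + k) - w₀‖ < |w₀.im| / 2 := by simpa [habs] using hk
  have hk'' : ‖k‖ < |w₀.im| / 2 := by simpa [habs] using hk
  have hwk : 0 < (w₀ + k).im := by
    have h1 : |k.im| ≤ ‖k‖ := Complex.abs_im_le_norm k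
    have h2 : -‖k‖ ≤ k.im := (abs_le.1 h1).1
    simp only [add_im]
    linarith
  refine ContinuousLinearMap.opNorm_le_bound _ (by positivity) fun x => ?_
  change ‖W (w₀ + k) x - W w₀ x - k • S x‖ ≤ _
  rw [poissonExtension_apply_eq_cauchy hW hT hwk, poissonExtension_apply_eq_cauchy hW hT hw₀, hS]
  simp_rw [mul_smul]
  rw [integral_smul, smul_comm k, ← smul_sub, ← smul_sub, norm_smul]
  have hnorm : ‖(2 * (Real.pi : ℂ) * I)⁻¹‖ = (2 * Real.pi)⁻¹ := by
    rw [norm_inv, norm_mul, norm_mul, Complex.norm_ofNat, Complex.norm_real, Complex.norm_I,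
      mul_one, Real.norm_of_nonneg Real.pi_pos.le]
  rw [hnorm]
  calc (2 * Real.pi)⁻¹ * ‖(∫ s : ℝ, (((s : ℂ) - (w₀ + k))⁻¹ - ((s : ℂ) + I)⁻¹) • T.appReal s x) -
        (∫ s : ℝ, (((s : ℂ) - w₀)⁻¹ - ((s : ℂ) + I)⁻¹) • T.appReal s x) -
        k • ∫ s : ℝ, (((s : ℂ) - w₀) ^ 2)⁻¹ • T.appReal s x‖
      ≤ (2 * Real.pi)⁻¹ * (2 * Real.pi / |w₀.im| ^ 2 * ‖x‖ * ‖k‖ ^ 2) := by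
        gcongr
        exact T.norm_integral_inv_sub_inv_taylor_le hw₀.ne' x hk''
    _ = (w₀.im ^ 2)⁻¹ * ‖k‖ ^ 2 * ‖x‖ := by
        rw [habs]
        field_simp

/-- **The Poisson extension is holomorphic on the upper half-plane** (operator norm). [folklore] -/
theorem differentiableOn_poissonExtension (hT : T.HasPositiveEnergy) :
    DifferentiableOn ℂ W {w : ℂ | 0 < w.im} := fun w hw => by
  obtain ⟨S, hS⟩ := hasDerivAt_poissonExtension hW hT hw
  exact hS.differentiableAt.differentiableWithinAt

end Holomorphy

/-! ### Summary -/

/-- **Analytic continuation of a positive-energy unitary group to the upper half-plane.** If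
`T(s) = e^{isP}` has positive energy, there is a family `W(w)`, `w ∈ ℂ`, of bounded operators with
`W(s) = T(s)` for real `s`, `‖W(w)‖ ≤ 1`, `(w, x) ↦ W(w)x` jointly continuous, and `w ↦ W(w)`
holomorphic (in operator norm) on the open upper half-plane `Im w > 0` — the elementary form of
"`w ↦ e^{iwP}` is a bounded analytic function on `Im w > 0`, strongly continuous up to the boundary"
used in the proof of the one-particle Borchers theorem (Longo, Thm. 2.2.1: "as `P ≥ 0` and
`Im e^{2πz}s ≥ 0` for `z ∈ 𝕊_{1/2}` … bounded and continuous … analytic").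
[cite: Longo2008LecturesConformalNets, Thm. 2.2.1 (proof)] -/
theorem exists_upperHalfPlane_extension (T : OneParameterUnitaryGroup H) (hT : T.HasPositiveEnergy) :
    ∃ W : ℂ → (H →L[ℂ] H), (∀ s : ℝ, W s = T.appReal s) ∧ (∀ w, ‖W w‖ ≤ 1) ∧
      Continuous (fun p : ℂ × H => W p.1 p.2) ∧ DifferentiableOn ℂ W {w : ℂ | 0 < w.im} := by
  obtain ⟨W, hW⟩ := T.exists_poissonExtension
  exact ⟨W, poissonExtension_ofReal hW, norm_poissonExtension_le hW,
    continuous_poissonExtension_uncurry hW, differentiableOn_poissonExtension hW hT⟩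

end UnitaryRep

end Literature.Analysis.UnboundedOperators
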